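/-
Copyright (c) 2026. All rights reserved.
Released under Apache 2.0 license as described in the file LICENSE.
Authors: abc-iut cell, seat abc-iut-f-066 (gen 6; row «P13v-TWO-VERTEX»).
-/
import Literature.GroupTheory.CombinatorialGroupTheory.FoxPathChains
import HarnessLib

/-!
# Fox path chains on three generators: the conjugation twist `c ↦ w^M c w^{-M}` and the division-free coset-sum test

Lyndon–Schupp, *Combinatorial Group Theory*, Ch. II §3 (Fox derivations `∂/∂x : F → ℤF`, the fundamental formula
`u - 1 = Σ_x (∂u/∂x)(x - 1)`, the chain rule `∂(σu)/∂x = Σ_y σ(∂u/∂y)·∂(σy)/∂x` for an endomorphism `σ`, all read in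
`k[G]` for a quotient `G` of `F`) [cite: LyndonSchupp2001, Ch. II §3].

GADGET + PROOF file (classical, self-contained; no `Prop` definitions, no instances, no notation), abc-iut-f-066 (gen 6),
the three-generator companion of abc-iut-f-069's `FoxPathChains.lean` (`FoxChain.rt/lt/e/csum` are consumed by name).
For a group `G` and a commutative ring `k`:

* `FoxChain.W3 G k = Multiplicative ((G→k) × (G→k) × (G→k)) ⋊ G` — the Fox group of `F(a₁,a₂,a₃) → G` (finite when
  `G`, `k` are), with the generator chains `w1 A₁ = ((𝟙,0,0),A₁)`, `w2 A₂`, `w3 A₃` and the subgroup `pathSub3 A₁ A₂ A₃`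
  of PATH CHAINS `∂(f₁,f₂,f₃) = ρ_{A₁}f₁ - f₁ + ρ_{A₂}f₂ - f₂ + ρ_{A₃}f₃ - f₃ = e_q - e_1`;
* `FoxChain.thetaConj A₁ A₂ A₃ M` — the endomorphism of `W3` induced on Fox chains by the CONJUGATION TWIST
  `a₁ ↦ a₁`, `a₂ ↦ a₂`, `a₃ ↦ w^M a₃ w^{-M}` (`w = a₁a₂`) when `W^M = (A₁A₂)^M` commutes with `A₃`:
  `Θ(f₁,f₂,f₃) = (f₁ + D, f₂ + ρ_{A₁} D, ρ_{W^M} f₃)` with `D = Σ_{j<M} ρ_{W^j}(f₃ - ρ_{A₃} f₃)` (`dConj`) — the chain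
  rule: `∂(w^M a₃ w^{-M})/∂a₁ = (1 - w^M a₃ w^{-M}) Σ_{j<M} w^j`, `…/∂a₂ = (1 - w^M a₃ w^{-M}) Σ_{j<M} w^j a₁`,
  `…/∂a₃ = w^M`; certified by `thetaConj_w1`, `thetaConj_w2`, `thetaConj_w3_mul` (`Θ(w3)·X = X·w3`, `X = (w1 w2)^M`);
* `FoxChain.mem_of_fox_chain₃` — **the coset-sum test, DIVISION-FREE**: over ANY commutative ring `k` with
  `(M : k) ≠ 0`, a path chain from `1` to `X` with `D = 0` has `X ∈ H` for every subgroup `H ∋ A₁, A₂` (sum the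
  boundary identity over `H`, which is right-stable under `A₁`, `A₂`, `W`: `M · ([X ∈ H] - 1) = 0`).  Division-freeness
  matters for PRO-`Σ` completions, where the Fox target must be a finite `Σ`-group, so `k = ZMod ℓ^N` (`ℓ ∈ Σ`,
  `ℓ^N > M`) replaces a field of characteristic `> M`.
This is the finite shadow of the Bass–Serre statement "an element of `A ∗ B` commuting with the twist that is the
identity on `A` and conjugation by `w ∈ A ∖ {1}` on `B` lies in `A`"; consumed by
`AbsTopII/TwoTripodNodalFixedSubgroup.lean` (fixed subgroup of the pro-`Σ` Dehn twist of the degenerating 4-pointed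
sphere).  Classical combinatorial group theory; nothing here bears on [IUTchIII] Cor 3.12.
-/

namespace Literature.GroupTheory.CombinatorialGroupTheory.FoxChain

/-! ### Coefficient sums over a subgroup -/

section Test

variable {G : Type*} [Group G] {k : Type*}

/-- The coefficient sum over a subgroup `H` is invariant under right translation by an element of `H`.
[cite: LyndonSchupp2001, Ch. II §3] -/
theorem csum_filter_rt [Fintype G] [AddCommMonoid k] (H : Subgroup G) [DecidablePred (· ∈ H)] {h : G}
    (hh : h ∈ H) (f : G → k) :
    csum (Finset.univ.filter (· ∈ H)) (rt h f) = csum (Finset.univ.filter (· ∈ H)) f := by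
  refine csum_rt _ _ h (fun q => ?_) f
  simp only [Finset.mem_filter, Finset.mem_univ, true_and]
  constructor
  · intro hq; exact H.mul_mem hq (H.inv_mem hh)
  · intro hq
    have := H.mul_mem hq hh
    rwa [inv_mul_cancel_right] at this

/-- **The coset-sum test for the conjugation twist, division-free.**  Let `H ≤ G` contain `A₁`, `A₂` (hence
`W = A₁A₂`), `k` any commutative ring with `(M : k) ≠ 0`.  If `(f₁,f₂,f₃)` is a path chain from `1` to `X`
(`ρ_{A₁}f₁ - f₁ + ρ_{A₂}f₂ - f₂ + ρ_{A₃}f₃ - f₃ = e_X - e_1`) with `Σ_{j<M} ρ_{W^j}(f₃ - ρ_{A₃}f₃) = 0`, then `X ∈ H`: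
summing the hypothesis over `H` gives `M · csum_H(f₃ - ρ_{A₃}f₃) = 0`, summing the boundary over `H` gives
`csum_H(ρ_{A₃}f₃ - f₃) = [X ∈ H] - 1`, whence `M · ([X ∈ H] - 1) = 0`. [cite: LyndonSchupp2001, Ch. II §3] -/
theorem mem_of_fox_chain₃ [Fintype G] [DecidableEq G] [CommRing k] (H : Subgroup G) [DecidablePred (· ∈ H)]
    {A₁ A₂ A₃ X : G} (hA₁ : A₁ ∈ H) (hA₂ : A₂ ∈ H) {M : ℕ} (hM : (M : k) ≠ 0) {f₁ f₂ f₃ : G → k}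
    (hE : rt A₁ f₁ - f₁ + (rt A₂ f₂ - f₂) + (rt A₃ f₃ - f₃) = e X - e 1)
    (hD : ∑ j ∈ Finset.range M, rt ((A₁ * A₂) ^ j) (f₃ - rt A₃ f₃) = 0) : X ∈ H := by
  set SH : Finset G := Finset.univ.filter (· ∈ H) with hSH
  have memSH : ∀ q, q ∈ SH ↔ q ∈ H := fun q => by simp [hSH]
  have hW : A₁ * A₂ ∈ H := H.mul_mem hA₁ hA₂
  -- `M · csum_H (f₃ - ρ_{A₃} f₃) = 0`
  have h1 : (M : k) * csum SH (f₃ - rt A₃ f₃) = 0 := by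
    have h := congrArg (csum SH) hD
    rw [map_sum, map_zero] at h
    have hj : ∀ j ∈ Finset.range M,
        csum SH (rt ((A₁ * A₂) ^ j) (f₃ - rt A₃ f₃)) = csum SH (f₃ - rt A₃ f₃) :=
      fun j _ => csum_filter_rt H (H.pow_mem hW j) _
    rw [Finset.sum_congr rfl hj, Finset.sum_const, Finset.card_range, nsmul_eq_mul] at h
    exact h
  -- the boundary identity summed over `H`
  by_contra hX
  have h := congrArg (csum SH) hE
  simp only [map_add, map_sub] at h
  have hX' : X ∉ SH := fun h' => hX ((memSH X).mp h')
  have h1' : (1 : G) ∈ SH := (memSH 1).mpr H.one_mem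
  rw [csum_filter_rt H hA₁, csum_filter_rt H hA₂, csum_e, csum_e, sub_self, sub_self, zero_add, zero_add,
    if_neg hX', if_pos h1', zero_sub] at h
  have h3 : csum SH (f₃ - rt A₃ f₃) = 1 := by
    rw [map_sub, ← neg_sub, h, neg_neg]
  rw [h3, mul_one] at h1
  exact hM h1

end Test

/-! ### The Fox group `W3 = (k^G × k^G × k^G) ⋊ G` -/

section FoxGroup3

variable {G : Type*} [Group G] {k : Type*} [CommRing k]

/-- The triple module `k^G × k^G × k^G`. [cite: LyndonSchupp2001, Ch. II §3] -/
abbrev V3 (G : Type*) (k : Type*) : Type _ := (G → k) × (G → k) × (G → k)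

/-- Left translation on triples, as a multiplicative automorphism. [cite: LyndonSchupp2001, Ch. II §3] -/
def foxAut3 (g : G) : MulAut (Multiplicative (V3 G k)) where
  toFun v := Multiplicative.ofAdd (lt g (Multiplicative.toAdd v).1, lt g (Multiplicative.toAdd v).2.1,
    lt g (Multiplicative.toAdd v).2.2)
  invFun v := Multiplicative.ofAdd (lt g⁻¹ (Multiplicative.toAdd v).1, lt g⁻¹ (Multiplicative.toAdd v).2.1,
    lt g⁻¹ (Multiplicative.toAdd v).2.2)
  left_inv v := by
    simp only [toAdd_ofAdd, ← lt_mul, inv_mul_cancel, lt_one, Prod.mk.eta, ofAdd_toAdd]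
  right_inv v := by
    simp only [toAdd_ofAdd, ← lt_mul, mul_inv_cancel, lt_one, Prod.mk.eta, ofAdd_toAdd]
  map_mul' v w := by
    simp only [toAdd_mul, Prod.fst_add, Prod.snd_add, lt_add, ← ofAdd_add, Prod.mk_add_mk]

/-- `foxAut3 g` acts by left translation on the three components. [cite: LyndonSchupp2001, Ch. II §3] -/
theorem foxAut3_apply (g : G) (v : Multiplicative (V3 G k)) :
    foxAut3 g v = Multiplicative.ofAdd (lt g (Multiplicative.toAdd v).1, lt g (Multiplicative.toAdd v).2.1,
      lt g (Multiplicative.toAdd v).2.2) := rfl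

/-- The action of `G` on `Multiplicative (k^G × k^G × k^G)` by left translation. [cite: LyndonSchupp2001, Ch. II §3] -/
def foxAct3 : G →* MulAut (Multiplicative (V3 G k)) where
  toFun := foxAut3
  map_one' := by
    refine MulEquiv.ext fun v => ?_
    simp only [foxAut3_apply, MulAut.one_apply, lt_one, Prod.mk.eta, ofAdd_toAdd]
  map_mul' g g' := by
    refine MulEquiv.ext fun v => ?_
    rw [MulAut.mul_apply, foxAut3_apply, foxAut3_apply, foxAut3_apply, toAdd_ofAdd, lt_mul, lt_mul, lt_mul]

/-- The action of `g` on `ofAdd (f₁, f₂, f₃)` is `ofAdd (λ_g f₁, λ_g f₂, λ_g f₃)`. [cite: LyndonSchupp2001, Ch. II §3] -/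
theorem foxAct3_apply (g : G) (v : V3 G k) :
    foxAct3 g (Multiplicative.ofAdd v) = Multiplicative.ofAdd (lt g v.1, lt g v.2.1, lt g v.2.2) := rfl

/-- Additive form of `foxAct3_apply`. [cite: LyndonSchupp2001, Ch. II §3] -/
theorem toAdd_foxAct3 (g : G) (v : Multiplicative (V3 G k)) :
    Multiplicative.toAdd (foxAct3 g v) =
      (lt g (Multiplicative.toAdd v).1, lt g (Multiplicative.toAdd v).2.1, lt g (Multiplicative.toAdd v).2.2) := rfl

/-- The Fox group `W3 = (k^G × k^G × k^G) ⋊ G` — the target of the Fox derivations of `F(a₁,a₂,a₃) → G` reduced to `G`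
(a finite group when `G` and `k` are finite). [cite: LyndonSchupp2001, Ch. II §3] -/
abbrev W3 (G : Type*) [Group G] (k : Type*) [CommRing k] : Type _ :=
  Multiplicative (V3 G k) ⋊[foxAct3] G

/-- The chain of the first generator: `((𝟙, 0, 0), A₁)`. [cite: LyndonSchupp2001, Ch. II §3] -/
def w1 [DecidableEq G] (A : G) : W3 G k := ⟨Multiplicative.ofAdd (e 1, 0, 0), A⟩

/-- The chain of the second generator: `((0, 𝟙, 0), A₂)`. [cite: LyndonSchupp2001, Ch. II §3] -/
def w2 [DecidableEq G] (A : G) : W3 G k := ⟨Multiplicative.ofAdd (0, e 1, 0), A⟩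

/-- The chain of the third generator: `((0, 0, 𝟙), A₃)`. [cite: LyndonSchupp2001, Ch. II §3] -/
def w3 [DecidableEq G] (A : G) : W3 G k := ⟨Multiplicative.ofAdd (0, 0, e 1), A⟩

/-- The Fox boundary `∂(f₁,f₂,f₃) = ρ_{A₁}f₁ - f₁ + (ρ_{A₂}f₂ - f₂) + (ρ_{A₃}f₃ - f₃)`. [cite: LyndonSchupp2001, Ch. II §3] -/
def bd3 (A₁ A₂ A₃ : G) (v : V3 G k) : G → k :=
  rt A₁ v.1 - v.1 + (rt A₂ v.2.1 - v.2.1) + (rt A₃ v.2.2 - v.2.2)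

/-- The Fox boundary is additive. [cite: LyndonSchupp2001, Ch. II §3] -/
theorem bd3_add (A₁ A₂ A₃ : G) (v w : V3 G k) : bd3 A₁ A₂ A₃ (v + w) = bd3 A₁ A₂ A₃ v + bd3 A₁ A₂ A₃ w := by
  simp only [bd3, Prod.fst_add, Prod.snd_add, rt_add]; abel

/-- The Fox boundary commutes with negation. [cite: LyndonSchupp2001, Ch. II §3] -/
theorem bd3_neg (A₁ A₂ A₃ : G) (v : V3 G k) : bd3 A₁ A₂ A₃ (-v) = -bd3 A₁ A₂ A₃ v := by
  simp only [bd3, Prod.fst_neg, Prod.snd_neg, rt_neg]; abel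

/-- The Fox boundary commutes with left translation. [cite: LyndonSchupp2001, Ch. II §3] -/
theorem bd3_lt (A₁ A₂ A₃ g : G) (v : V3 G k) :
    bd3 A₁ A₂ A₃ (lt g v.1, lt g v.2.1, lt g v.2.2) = lt g (bd3 A₁ A₂ A₃ v) := by
  simp only [bd3, lt_add, lt_sub, lt_rt]

/-- The subgroup `{(v, q) : ∂ v = e_q - e_1}` of PATH CHAINS of the Fox group `W3`. [cite: LyndonSchupp2001, Ch. II §3] -/
def pathSub3 [DecidableEq G] (A₁ A₂ A₃ : G) : Subgroup (W3 G k) where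
  carrier := {w | bd3 A₁ A₂ A₃ (Multiplicative.toAdd w.left) = e w.right - e 1}
  one_mem' := by
    show bd3 A₁ A₂ A₃ (Multiplicative.toAdd (1 : W3 G k).left) = e (1 : W3 G k).right - e 1
    show bd3 A₁ A₂ A₃ (0 : V3 G k) = e (1 : G) - e 1
    simp only [bd3, Prod.fst_zero, Prod.snd_zero, rt_zero, sub_self, add_zero]
  mul_mem' {w w'} hw hw' := by
    change bd3 A₁ A₂ A₃ _ = _ at hw
    change bd3 A₁ A₂ A₃ _ = _ at hw'
    show bd3 A₁ A₂ A₃ (Multiplicative.toAdd (w * w').left) = e (w * w').right - e 1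
    rw [SemidirectProduct.mul_left, SemidirectProduct.mul_right, toAdd_mul, bd3_add, hw, toAdd_foxAct3,
      bd3_lt, hw', lt_sub, lt_e, lt_e, mul_one]
    abel
  inv_mem' {w} hw := by
    change bd3 A₁ A₂ A₃ _ = _ at hw
    show bd3 A₁ A₂ A₃ (Multiplicative.toAdd w⁻¹.left) = e w⁻¹.right - e 1
    rw [SemidirectProduct.inv_left, SemidirectProduct.inv_right, toAdd_foxAct3, toAdd_inv, bd3_lt, bd3_neg, hw,
      lt_neg, lt_sub, lt_e, lt_e, mul_one, inv_mul_cancel]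
    abel

/-- Membership in the path-chain subgroup, unfolded. [cite: LyndonSchupp2001, Ch. II §3] -/
theorem mem_pathSub3_iff [DecidableEq G] (A₁ A₂ A₃ : G) (w : W3 G k) :
    w ∈ pathSub3 A₁ A₂ A₃ ↔ bd3 A₁ A₂ A₃ (Multiplicative.toAdd w.left) = e w.right - e 1 := Iff.rfl

/-- `w1` is a path chain from `1` to `A₁`. [cite: LyndonSchupp2001, Ch. II §3] -/
theorem w1_mem_pathSub3 [DecidableEq G] (A₁ A₂ A₃ : G) : (w1 A₁ : W3 G k) ∈ pathSub3 A₁ A₂ A₃ := by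
  rw [mem_pathSub3_iff, w1]
  simp only [toAdd_ofAdd, bd3, rt_zero, sub_zero, add_zero, rt_e, one_mul]

/-- `w2` is a path chain from `1` to `A₂`. [cite: LyndonSchupp2001, Ch. II §3] -/
theorem w2_mem_pathSub3 [DecidableEq G] (A₁ A₂ A₃ : G) : (w2 A₂ : W3 G k) ∈ pathSub3 A₁ A₂ A₃ := by
  rw [mem_pathSub3_iff, w2]
  simp only [toAdd_ofAdd, bd3, rt_zero, sub_zero, add_zero, zero_add, rt_e, one_mul]

/-- `w3` is a path chain from `1` to `A₃`. [cite: LyndonSchupp2001, Ch. II §3] -/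
theorem w3_mem_pathSub3 [DecidableEq G] (A₁ A₂ A₃ : G) : (w3 A₃ : W3 G k) ∈ pathSub3 A₁ A₂ A₃ := by
  rw [mem_pathSub3_iff, w3]
  simp only [toAdd_ofAdd, bd3, rt_zero, sub_zero, zero_add, rt_e, one_mul]

/-! ### The chain endomorphism of the conjugation twist `a₃ ↦ w^M a₃ w^{-M}` -/

/-- The correction chain `D(f₃) = Σ_{j<M} ρ_{W^j} (f₃ - ρ_{A₃} f₃)` (`= f₃ · (1 - A₃) · Σ_{j<M} W^j` in `k[G]`).
[cite: LyndonSchupp2001, Ch. II §3] -/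
def dConj (W A₃ : G) (M : ℕ) (f : G → k) : G → k := ∑ j ∈ Finset.range M, rt (W ^ j) (f - rt A₃ f)

/-- `D` is additive. [cite: LyndonSchupp2001, Ch. II §3] -/
theorem dConj_add (W A₃ : G) (M : ℕ) (f f' : G → k) : dConj W A₃ M (f + f') = dConj W A₃ M f + dConj W A₃ M f' := by
  simp only [dConj, rt_add, ← Finset.sum_add_distrib]
  refine Finset.sum_congr rfl fun j _ => ?_
  funext q
  simp only [rt_apply, Pi.add_apply, Pi.sub_apply]
  abel

/-- `D 0 = 0`. [cite: LyndonSchupp2001, Ch. II §3] -/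
theorem dConj_zero (W A₃ : G) (M : ℕ) : dConj W A₃ M (0 : G → k) = 0 := by
  simp only [dConj, rt_zero, sub_self, Finset.sum_const_zero]

/-- `D` commutes with left translation. [cite: LyndonSchupp2001, Ch. II §3] -/
theorem dConj_lt (W A₃ : G) (M : ℕ) (g : G) (f : G → k) : dConj W A₃ M (lt g f) = lt g (dConj W A₃ M f) := by
  simp only [dConj, lt_sum, lt_rt, lt_sub]

/-- The linear map `Θ(f₁,f₂,f₃) = (f₁ + D f₃, f₂ + ρ_{A₁} D f₃, ρ_{W^M} f₃)`, `W = A₁A₂`, as a group endomorphism of `W3`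
— what the substitution `a₁ ↦ a₁`, `a₂ ↦ a₂`, `a₃ ↦ w^M a₃ w^{-M}` does to Fox chains when `W^M` commutes with `A₃`
(`thetaConj_w1`, `thetaConj_w2`, `thetaConj_w3_mul`). [cite: LyndonSchupp2001, Ch. II §3] -/
def thetaConj (A₁ A₂ A₃ : G) (M : ℕ) : W3 G k →* W3 G k where
  toFun w := ⟨Multiplicative.ofAdd ((Multiplicative.toAdd w.left).1 + dConj (A₁ * A₂) A₃ M (Multiplicative.toAdd w.left).2.2,
      (Multiplicative.toAdd w.left).2.1 + rt A₁ (dConj (A₁ * A₂) A₃ M (Multiplicative.toAdd w.left).2.2),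
      rt ((A₁ * A₂) ^ M) (Multiplicative.toAdd w.left).2.2), w.right⟩
  map_one' := by
    refine SemidirectProduct.ext ?_ rfl
    show Multiplicative.ofAdd ((0 : V3 G k).1 + dConj (A₁ * A₂) A₃ M (0 : V3 G k).2.2,
      (0 : V3 G k).2.1 + rt A₁ (dConj (A₁ * A₂) A₃ M (0 : V3 G k).2.2), rt ((A₁ * A₂) ^ M) (0 : V3 G k).2.2) =
        Multiplicative.ofAdd 0
    simp only [Prod.fst_zero, Prod.snd_zero, dConj_zero, rt_zero, add_zero, Prod.mk_zero_zero]
  map_mul' w w' := by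
    refine SemidirectProduct.ext ?_ rfl
    apply Multiplicative.toAdd.injective
    simp only [SemidirectProduct.mul_left, toAdd_mul, toAdd_ofAdd, toAdd_foxAct3, Prod.fst_add,
      Prod.snd_add, Prod.mk_add_mk, rt_add, dConj_add, dConj_lt, lt_add, lt_rt]
    refine Prod.ext ?_ (Prod.ext ?_ rfl)
    · simp only
      abel
    · simp only
      abel

/-- Unfolding `thetaConj`. [cite: LyndonSchupp2001, Ch. II §3] -/
theorem thetaConj_apply (A₁ A₂ A₃ : G) (M : ℕ) (w : W3 G k) :
    thetaConj A₁ A₂ A₃ M w = ⟨Multiplicative.ofAdd ((Multiplicative.toAdd w.left).1 +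
        dConj (A₁ * A₂) A₃ M (Multiplicative.toAdd w.left).2.2,
      (Multiplicative.toAdd w.left).2.1 + rt A₁ (dConj (A₁ * A₂) A₃ M (Multiplicative.toAdd w.left).2.2),
      rt ((A₁ * A₂) ^ M) (Multiplicative.toAdd w.left).2.2), w.right⟩ := rfl

/-- `Θ (w1) = w1` (the twist fixes `a₁`). [cite: LyndonSchupp2001, Ch. II §3] -/
theorem thetaConj_w1 [DecidableEq G] (A₁ A₂ A₃ : G) (M : ℕ) : thetaConj A₁ A₂ A₃ M (w1 A₁ : W3 G k) = w1 A₁ := by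
  rw [thetaConj_apply, w1]
  refine SemidirectProduct.ext ?_ rfl
  simp only [toAdd_ofAdd, dConj_zero, rt_zero, add_zero]

/-- `Θ (w2) = w2` (the twist fixes `a₂`). [cite: LyndonSchupp2001, Ch. II §3] -/
theorem thetaConj_w2 [DecidableEq G] (A₁ A₂ A₃ : G) (M : ℕ) : thetaConj A₁ A₂ A₃ M (w2 A₂ : W3 G k) = w2 A₂ := by
  rw [thetaConj_apply, w2]
  refine SemidirectProduct.ext ?_ rfl
  simp only [toAdd_ofAdd, dConj_zero, rt_zero, add_zero]

/-- The chain of `w = a₁a₂`: `w1 · w2 = ((e_1, e_{A₁}, 0), A₁A₂)`. [cite: LyndonSchupp2001, Ch. II §3] -/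
theorem w1_mul_w2 [DecidableEq G] (A₁ A₂ : G) :
    (w1 A₁ : W3 G k) * w2 A₂ = ⟨Multiplicative.ofAdd (e 1, e A₁, 0), A₁ * A₂⟩ := by
  rw [w1, w2]
  refine SemidirectProduct.ext ?_ rfl
  rw [SemidirectProduct.mul_left, foxAct3_apply, ← ofAdd_add, Prod.mk_add_mk, Prod.mk_add_mk]
  simp only [lt_zero, lt_e, mul_one, add_zero, zero_add]

/-- Powers of the chain of `w`: `(w1 w2)^j = ((Σ_{l<j} e_{W^l}, Σ_{l<j} e_{W^l A₁}, 0), W^j)`, `W = A₁A₂` (the path of `w^j`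
uses the `a₁`-edges at `W^l` and the `a₂`-edges at `W^l A₁`). [cite: LyndonSchupp2001, Ch. II §3] -/
theorem w1_mul_w2_pow [DecidableEq G] (A₁ A₂ : G) (j : ℕ) :
    ((w1 A₁ : W3 G k) * w2 A₂) ^ j =
      ⟨Multiplicative.ofAdd (∑ l ∈ Finset.range j, e ((A₁ * A₂) ^ l),
        ∑ l ∈ Finset.range j, e ((A₁ * A₂) ^ l * A₁), 0), (A₁ * A₂) ^ j⟩ := by
  induction j with
  | zero =>
    refine SemidirectProduct.ext ?_ ?_
    · show (1 : Multiplicative (V3 G k)) = _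
      rw [Finset.sum_range_zero, Finset.sum_range_zero]
      rfl
    · show (1 : G) = (A₁ * A₂) ^ 0
      rw [pow_zero]
  | succ j ih =>
    rw [pow_succ, ih, w1_mul_w2]
    refine SemidirectProduct.ext ?_ ?_
    · rw [SemidirectProduct.mul_left, foxAct3_apply, ← ofAdd_add, Prod.mk_add_mk, Prod.mk_add_mk]
      simp only [lt_zero, lt_e, add_zero, mul_one, Finset.sum_range_succ]
    · rw [SemidirectProduct.mul_right, pow_succ]

/-- The correction chain of the edge `e_1`: `D(e_1) = Σ_{j<M} (e_{W^j} - e_{A₃ W^j})`. [cite: LyndonSchupp2001, Ch. II §3] -/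
theorem dConj_e_one [DecidableEq G] (W A₃ : G) (M : ℕ) :
    dConj W A₃ M (e 1 : G → k) = ∑ j ∈ Finset.range M, (e (W ^ j) - e (A₃ * W ^ j)) := by
  simp only [dConj, rt_sub, rt_e, one_mul]

/-- **`Θ(w3) · X = X · w3` for `X = (w1 w2)^M`, provided `W^M A₃ = A₃ W^M`**: on Fox chains, `Θ` IS the substitution
`a₃ ↦ w^M a₃ w^{-M}` (the chain of the path `w^M a₃ w^{-M}` is `(1 - A₃)·c(w^M) + W^M e⃗₃`). [cite: LyndonSchupp2001, Ch. II §3] -/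
theorem thetaConj_w3_mul [DecidableEq G] (A₁ A₂ A₃ : G) (M : ℕ) (hcomm : (A₁ * A₂) ^ M * A₃ = A₃ * (A₁ * A₂) ^ M) :
    thetaConj A₁ A₂ A₃ M (w3 A₃ : W3 G k) * ((w1 A₁ * w2 A₂) ^ M) = ((w1 A₁ * w2 A₂) ^ M) * w3 A₃ := by
  rw [w1_mul_w2_pow, thetaConj_apply, w3]
  refine SemidirectProduct.ext ?_ ?_
  · apply Multiplicative.toAdd.injective
    simp only [SemidirectProduct.mul_left, toAdd_mul, toAdd_ofAdd, toAdd_foxAct3, Prod.mk_add_mk, zero_add, add_zero,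
      lt_zero, lt_e, mul_one, one_mul, lt_sum, dConj_e_one, rt_sum, rt_sub, rt_e, Finset.sum_sub_distrib, mul_assoc]
    refine Prod.ext ?_ (Prod.ext ?_ rfl)
    · simp only
      abel
    · simp only
      abel
  · show A₃ * (A₁ * A₂) ^ M = (A₁ * A₂) ^ M * A₃
    exact hcomm.symm

/-- **`Θ(w3) = X · w3 · X⁻¹`**, `X = (w1 w2)^M`, provided `W^M A₃ = A₃ W^M`. [cite: LyndonSchupp2001, Ch. II §3] -/
theorem thetaConj_w3 [DecidableEq G] (A₁ A₂ A₃ : G) (M : ℕ) (hcomm : (A₁ * A₂) ^ M * A₃ = A₃ * (A₁ * A₂) ^ M) :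
    thetaConj A₁ A₂ A₃ M (w3 A₃ : W3 G k) = ((w1 A₁ * w2 A₂) ^ M) * w3 A₃ * ((w1 A₁ * w2 A₂) ^ M)⁻¹ := by
  rw [eq_mul_inv_iff_mul_eq]
  exact thetaConj_w3_mul A₁ A₂ A₃ M hcomm

/-- A fixed point of `Θ` has vanishing correction chain: `D(f₃) = 0`. [cite: LyndonSchupp2001, Ch. II §3] -/
theorem dConj_eq_zero_of_thetaConj_eq (A₁ A₂ A₃ : G) (M : ℕ) (w : W3 G k) (hw : thetaConj A₁ A₂ A₃ M w = w) :
    dConj (A₁ * A₂) A₃ M (Multiplicative.toAdd w.left).2.2 = 0 := by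
  have h := congrArg (fun z : W3 G k => (Multiplicative.toAdd z.left).1) hw
  simp only [thetaConj_apply, toAdd_ofAdd] at h
  simpa using h

/-- The correction chain, unfolded (the shape consumed by `mem_of_fox_chain₃`). [cite: LyndonSchupp2001, Ch. II §3] -/
theorem dConj_def (W A₃ : G) (M : ℕ) (f : G → k) :
    dConj W A₃ M f = ∑ j ∈ Finset.range M, rt (W ^ j) (f - rt A₃ f) := rfl

end FoxGroup3

end Literature.GroupTheory.CombinatorialGroupTheory.FoxChain
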